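import Mathlib
import HarnessLib
import Summits.BirchSwinnertonDyer.BirchSwinnertonDyer.Theorems.GoldfeldGoodTwistsAllTwistsX049
import Summits.BirchSwinnertonDyer.Rank1Residual.P2.RouteTargetsAtTwo
import Summits.BirchSwinnertonDyer.BirchSwinnertonDyer.Theses.GoldfeldAllTwistsTwoConverse

/-! # BC3 birth skeleton — crux `BSDTwoCMSplitRankOne` (formula twin) of route `GoldfeldAllTwistsTwoConverse`
(planner bsd-goldfeld-plan g5, 2026-08-25; item stmt-BirchSwinnertonDyer-19350)

REGIME SPLIT at the prime `2` inside `BSDTwoOn` (good reduction = LTYZ Thm 1.1 (ii) cell; not-good = additive =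
the open cell), composition PROVED: `BSDTwoCMSplitRankOne_of : Sig.stub_bsdTwo_cmSplit_good →
Sig.stub_bsdTwo_cmSplit_additive → BSDTwoCMSplitRankOne` (the crux BY NAME). Sorries ONLY inside `stub_*`. -/

set_option linter.dupNamespace false
set_option autoImplicit false

namespace Summit.BirchSwinnertonDyer.BirchSwinnertonDyer.Cruxes.BSDTwoCMSplitRankOne.Birth

open Summit.BirchSwinnertonDyer.BirchSwinnertonDyer.Theses.GoldfeldAllTwistsTwoConverse

open Literature.NumberTheory.EllipticCurves Literature.NumberTheory.EllipticCurves.Rank1Residual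

/-! ## Legend: the stub statements as named propositions (verbatim the registered signatures) -/

/-- Statement of `stub_bsdTwo_cmSplit_good`. -/
def Sig.stub_bsdTwo_cmSplit_good : Prop :=
  ∀ (W : WeierstrassCurve ℚ) [W.IsElliptic] [W.IsGloballyMinimal], W.HasCM → CMSplit W 2 →
    W.HasGoodReductionAtPrime 2 → W.analyticRank = 1 → BSDp W 2

/-- Statement of `stub_bsdTwo_cmSplit_additive`. -/
def Sig.stub_bsdTwo_cmSplit_additive : Prop :=
  ∀ (W : WeierstrassCurve ℚ) [W.IsElliptic] [W.IsGloballyMinimal], W.HasCM → CMSplit W 2 →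
    ¬ W.HasGoodReductionAtPrime 2 → W.analyticRank = 1 → BSDp W 2

/-! ## Registered stubs (`sorry` only here) -/

/-- STUB (M/L; in print). The GOOD cell of the twin: CM, `2` split in the CM field, good reduction at `2`
(⟹ good ordinary: Deuring, `2` split), analytic rank `1` ⟹ `BSD(W, 2)` — Li–Tian–Yan–Zhu 2025 Thm 1.1 (ii)
(tree fact `LiTianYanZhu2025.thm11_bsdp_of_cm_rank_one` via `bsdp_two_of_goodOrd`; the only work is
ordinarity `¬ 2 ∣ a_2` from `CMSplit W 2` + good reduction). -/
theorem stub_bsdTwo_cmSplit_good :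
    ∀ (W : WeierstrassCurve ℚ) [W.IsElliptic] [W.IsGloballyMinimal], W.HasCM → CMSplit W 2 →
      W.HasGoodReductionAtPrime 2 → W.analyticRank = 1 → BSDp W 2 := by
  sorry

/-- STUB (XL; the OPEN content of the twin). The ADDITIVE cell: CM by an order of `ℚ(√−7)`, bad (additive,
potentially good ordinary) reduction at `2`, analytic rank `1` ⟹ `BSD(W, 2)` — LTYZ §1.3 (II)'s excluded
case; attack via the tree's `L`-free Heegner-index equivalence `P2.bsdp_two_iff_cmHeegnerIndex` (explicit
`2`-part of Gross–Zagier for the twist + a `2`-adic Kolyvagin/anticyclotomic bound with `2` split). -/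
theorem stub_bsdTwo_cmSplit_additive :
    ∀ (W : WeierstrassCurve ℚ) [W.IsElliptic] [W.IsGloballyMinimal], W.HasCM → CMSplit W 2 →
      ¬ W.HasGoodReductionAtPrime 2 → W.analyticRank = 1 → BSDp W 2 := by
  sorry

/-! ## Composition (PROVED): the dichotomy good / not-good at `2` inside `BSDTwoOn` -/

theorem BSDTwoCMSplitRankOne_of :
    Sig.stub_bsdTwo_cmSplit_good → Sig.stub_bsdTwo_cmSplit_additive → BSDTwoCMSplitRankOne := by
  intro h₁ h₂ W _ _ _ hC
  obtain ⟨hCM, hsplit, har⟩ := hC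
  by_cases hg : W.HasGoodReductionAtPrime 2
  · exact h₁ W hCM hsplit hg har
  · exact h₂ W hCM hsplit hg har

/-- The crux by name, closed modulo the two registered stubs. -/
theorem bsdTwoCMSplitRankOne_of_stubs : BSDTwoCMSplitRankOne :=
  BSDTwoCMSplitRankOne_of
    (fun W _ _ hCM hs hg har => stub_bsdTwo_cmSplit_good W hCM hs hg har)
    (fun W _ _ hCM hs hg har => stub_bsdTwo_cmSplit_additive W hCM hs hg har)

end Summit.BirchSwinnertonDyer.BirchSwinnertonDyer.Cruxes.BSDTwoCMSplitRankOne.Birth
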